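import Summits.BirchSwinnertonDyer.BirchSwinnertonDyer.Theorems.PrintX10bHeegnerRoad
import Summits.BirchSwinnertonDyer.Rank1Residual.X10.GreenbergMuBridgeSmallImage
import Literature.NumberTheory.EllipticCurves.SkinnerUrban2014.PAdicUnitPeriodRatioProofs
import HarnessLib

/-!
# Route PrintX10b — the X10b leaf with NO Schneider certificate, NO Kato package and NO analytic `μ`:
# the class-restricted ALGEBRAIC `μ = 0` at `3` (seat p1's Greenberg road, p546133) feeding the typed
# rank-`0` engine of seat p4's Heegner road at `3` (`PrintX10bHeegnerRoad`, §3)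

Cell `bsd-print-x9` (D-0131 (2) PRINT tier, leaves ClassX9 + ClassX10b), seat `bsd-print-x9-p1` (prover p1),
gen 2. Support file of crux 20682 (`AnalyticMuZeroX10b`) — a banked ALTERNATIVE decomposition of the
X10b leaf; the route's own assembly is `X10.printX10b_assembly_proof` (p546884).

HONEST FRAMING. BSD is not proved; no class is closed; nothing is booked. Seat p4's
`X10.bsdpOnClassX10b_of_mazurMainConjectureOnClassX10b_of_heegnerRoad` /
`…_of_heegnerDivisibility` (this cell, today) give the leaf `X10.BSDpOnClassX10b` from PUBLISHED facts, the
CM corner facts, the typed rank-`0` engine `hA3 : X10.MazurMainConjectureOnClassX10b` (X_A3) and EITHER the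
named Tamagawa residual «`BSD(E,3)` at the non-CM rank-`1` X10b pairs with `3 ∣ ∏c_ℓ`» (`hTam`) OR Heegner
divisibility to Tamagawa depth on the non-CM rank-`1` members (`hJ3`) — no Schneider certificate. Seat p1's
`X10.mazurMainConjectureOnClassX10b_of_muZeroSmallImageThree` (p546133) gives X_A3 from the
class-restricted algebraic `μ = 0`

  (μ3)  every `Λ`-torsion dual Selmer datum of every globally minimal `V/ℚ` good ordinary at `3` with
        `E[3]` irreducible and `ρ̄_{V,3}` not surjective has `μ = 0`

plus Yan–Zhu Thm 4.2 (1) / 4.9 / Lemma 5.3 / Prop 3.7, modularity ×2, Mazur's odd Manin constant (period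
unit at `3`, `SkinnerUrban2014.realPeriodRat_eq_unit_mul_plusPeriod_three_of_mazur`) and Matar–Nekovář
5.26 (2)(3) — no Kato fine-quotient package (F1 / E114), no analytic certificate. Composing:

* `bsdpOnClassX10b_of_muZeroSmallImageThree_of_heegnerRoad` — leaf ⟸ (μ3) ∧ `hTam` ∧ PUB ∧ CM facts;
* `bsdpOnClassX10b_of_muZeroSmallImageThree_of_heegnerDivisibility` — leaf ⟸ (μ3) ∧ `hJ3` ∧ PUB ∧ CM facts.

So the X10b leaf's non-print inputs on this composite road are exactly {(μ3), J-at-3 (or the Tamagawa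
residual)} — the `p = 3` twin of `Theorems/PrintX9GreenbergMuRoad` ({(μX9), J}). Flags riding:
`YZ26@3-BF-ERL-Ohta` (h49, h42, h57), `Cha05-Rmk25-structure`, the CM-corner facts' words. beyond-print
theorem: no.

References: [GreenbergLNM1716] §1 Conj. 1.11, Thm. 4.1; [YanZhu2024MainConjNonCM] Thm. 4.2 (1), 4.9, 5.7 (1),
Lemma 5.3, Prop. 3.7; [Cha2005] Rmk. 25; [MatarNekovar2019] Prop. 5.26; [JetchevSkinnerWan2017] Thm. 3.3.1,
§7.4; [Mazur1978] Cor. 4.1; [Rubin1991] Thm. 11.1; [Miller2011LMS] Def. 1.1.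
-/

set_option autoImplicit false

noncomputable section

open scoped Classical

open WeierstrassCurve Literature.NumberTheory.GaloisRepresentations
open Literature.NumberTheory.EllipticCurves Literature.NumberTheory.EllipticCurves.ModularForms
open Literature.NumberTheory.EllipticCurves.Rank1Residual (Surj ClassX10)
open Literature.NumberTheory.EllipticCurves.YanZhu2026
open Literature.NumberTheory.EllipticCurves.JetchevSkinnerWan2017 (thm331_anticyclotomicControl)

namespace Summit.BirchSwinnertonDyer.Rank1Residual.X10

/-- **The X10b leaf ⟸ (μ3) ∧ the Tamagawa residual ∧ PUBLISHED facts ∧ the CM corner facts** — seat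
p4's `…_of_mazurMainConjectureOnClassX10b_of_heegnerRoad` with its engine binder `hA3` supplied by
`mazurMainConjectureOnClassX10b_of_muZeroSmallImageThree` (period unit at `3` from Mazur's Manin constant
`hMaz`). No Schneider certificate, no Kato package, no analytic `μ`. CONDITIONAL on (μ3) and `hTam`;
nothing booked. [cite: GreenbergLNM1716, §1 Conj. 1.11] [cite: Cha2005, Rmk. 25 (p. 175)]
[cite: YanZhu2024MainConjNonCM, Thm. 5.7 (1), Thm. 4.9] [cite: Miller2011LMS, §1 and Def. 1.1] -/
theorem bsdpOnClassX10b_of_muZeroSmallImageThree_of_heegnerRoad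
    (hμ3 : ∀ (V : WeierstrassCurve ℚ) [V.IsElliptic] [V.IsGloballyMinimal],
      V.HasGoodReductionAtPrime 3 → ¬ ((3 : ℕ) : ℤ) ∣ V.frobeniusTrace 3 →
      V.HasIrreducibleModPGaloisRep 3 → ¬ V.HasSurjectiveModNGaloisRep 3 →
      ∀ (κ : ZpExtension ℚ 3) (γ : Field.absoluteGaloisGroup ℚ),
        κ.IsCyclotomic → κ.IsTopGenerator γ → IsCyclotomicVariable 3 γ →
        ∀ D : V.SelmerDualData κ γ, D.IsTorsion → D.mu = 0)
    (hGZ : ∀ (N : ℕ) [NeZero N] (W : WeierstrassCurve ℚ) (K : Type) [Field K] [NumberField K],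
      gross_zagier N W K)
    (hKo : ∀ (N : ℕ) [NeZero N] (W : WeierstrassCurve ℚ) (K : Type) [Field K] [NumberField K],
      kolyvagin N W K)
    (hrec : ∀ (N : ℕ) [NeZero N] (W : WeierstrassCurve ℚ) (K : Type) [Field K] [NumberField K],
      heegnerPointOfConductor_one_galoisConj N W K)
    (hD36 : ∀ (N : ℕ) [NeZero N] (W : WeierstrassCurve ℚ) (K : Type) [Field K] [NumberField K],
      phi_heegnerTau_mem_singularModuliField N W K)
    (hChaU : Cha2005.rmk25_padicValNat_card_sha_primary_add_le_of_globalDivisibility)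
    (h526 : MatarNekovar2019.prop526_hasIrreducibleModPGaloisRep_baseChange)
    (h526c : MatarNekovar2019.prop526_three_of_irreducible_of_not_isAbsolutelyIrreducible)
    (h57 : thm57_bcs422_cgls513_generator_constantCoeff)
    (h331 : thm331_anticyclotomicControl)
    (h42 : thm42_XOrd₂_isTorsion_charIdeal_le_perrinRiou)
    (h49 : thm49_charIdeal_eq_padicLFunction)
    (h53 : lemma53_charIdeal_mul_charIdeal_le_toPlus_charIdeal)
    (h37 : prop37_cycRestrict_perrinRiou_eq_padicLFunction_mul)
    (hGr : greenberg_charValue_rankZero) (hGZK : rank_eq_analyticRank_of_analyticRank_le_one)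
    (hmod : hasEntireLFunction_rat) (hpar : nonempty_modularParametrizationData)
    (hnf : exists_isNewformOf) (hHL : HoffsteinLuo1997_exists_twist_L_one_ne_zero)
    (hMaz : mazur_not_dvd_maninConstant_of_odd) (hNS : integral_neronScaling_of_isGloballyMinimal)
    (hCM : bsdTriple_of_hasCM_of_L_one_ne_zero) (hLLT : LiLiuTian2024.thm11_bsdp_of_cm_rank_one)
    (hKob : Kobayashi2013.cor14_bsdp_of_cm_rank_one)
    (hTam : ∀ (W : WeierstrassCurve ℚ) [W.IsElliptic] [W.IsGloballyMinimal] (p : ℕ) [Fact p.Prime],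
      ClassX10 W p → ¬ Surj W 3 → ¬ W.HasCM → W.analyticRank = 1 → p ∣ W.tamagawaProduct → BSDp W p) :
    BSDpOnClassX10b :=
  Summit.BirchSwinnertonDyer.BirchSwinnertonDyer.Rank1Residual.X10.bsdpOnClassX10b_of_mazurMainConjectureOnClassX10b_of_heegnerRoad
    hGZ hKo hrec hD36 hChaU h526 h57 h331 hGr hGZK hmod hpar hnf hHL hMaz hNS hCM hLLT hKob
    (mazurMainConjectureOnClassX10b_of_muZeroSmallImageThree hμ3 h42 h49 h53 h37 hnf hpar
      (SkinnerUrban2014.realPeriodRat_eq_unit_mul_plusPeriod_three_of_mazur hMaz) h526 h526c) hTam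

/-- **The X10b leaf ⟸ (μ3) ∧ Heegner divisibility to Tamagawa depth on the non-CM rank-`1` members
(`hJ3`, the X10b analogue of crux J) ∧ PUBLISHED facts ∧ the CM corner facts** — seat p4's
`…_of_mazurMainConjectureOnClassX10b_of_heegnerDivisibility` with `hA3` from
`mazurMainConjectureOnClassX10b_of_muZeroSmallImageThree`. On this road the X10b leaf's non-print inputs are
exactly {(μ3), J-at-3}. CONDITIONAL; nothing booked.
[cite: GreenbergLNM1716, §1 Conj. 1.11] [cite: Cha2005, Rmk. 25 (p. 175)] [cite: Jetchev2008, Conj. 1.3]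
[cite: YanZhu2024MainConjNonCM, Thm. 5.7 (1), Thm. 4.9] [cite: Miller2011LMS, §1 and Def. 1.1] -/
theorem bsdpOnClassX10b_of_muZeroSmallImageThree_of_heegnerDivisibility
    (hμ3 : ∀ (V : WeierstrassCurve ℚ) [V.IsElliptic] [V.IsGloballyMinimal],
      V.HasGoodReductionAtPrime 3 → ¬ ((3 : ℕ) : ℤ) ∣ V.frobeniusTrace 3 →
      V.HasIrreducibleModPGaloisRep 3 → ¬ V.HasSurjectiveModNGaloisRep 3 →
      ∀ (κ : ZpExtension ℚ 3) (γ : Field.absoluteGaloisGroup ℚ),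
        κ.IsCyclotomic → κ.IsTopGenerator γ → IsCyclotomicVariable 3 γ →
        ∀ D : V.SelmerDualData κ γ, D.IsTorsion → D.mu = 0)
    (hGZ : ∀ (N : ℕ) [NeZero N] (W : WeierstrassCurve ℚ) (K : Type) [Field K] [NumberField K],
      gross_zagier N W K)
    (hKo : ∀ (N : ℕ) [NeZero N] (W : WeierstrassCurve ℚ) (K : Type) [Field K] [NumberField K],
      kolyvagin N W K)
    (hrec : ∀ (N : ℕ) [NeZero N] (W : WeierstrassCurve ℚ) (K : Type) [Field K] [NumberField K],
      heegnerPointOfConductor_one_galoisConj N W K)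
    (hD36 : ∀ (N : ℕ) [NeZero N] (W : WeierstrassCurve ℚ) (K : Type) [Field K] [NumberField K],
      phi_heegnerTau_mem_singularModuliField N W K)
    (hChaU : Cha2005.rmk25_padicValNat_card_sha_primary_add_le_of_globalDivisibility)
    (h526 : MatarNekovar2019.prop526_hasIrreducibleModPGaloisRep_baseChange)
    (h526c : MatarNekovar2019.prop526_three_of_irreducible_of_not_isAbsolutelyIrreducible)
    (h57 : thm57_bcs422_cgls513_generator_constantCoeff)
    (h331 : thm331_anticyclotomicControl)
    (h42 : thm42_XOrd₂_isTorsion_charIdeal_le_perrinRiou)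
    (h49 : thm49_charIdeal_eq_padicLFunction)
    (h53 : lemma53_charIdeal_mul_charIdeal_le_toPlus_charIdeal)
    (h37 : prop37_cycRestrict_perrinRiou_eq_padicLFunction_mul)
    (hGr : greenberg_charValue_rankZero) (hGZK : rank_eq_analyticRank_of_analyticRank_le_one)
    (hmod : hasEntireLFunction_rat) (hpar : nonempty_modularParametrizationData)
    (hnf : exists_isNewformOf) (hHL : HoffsteinLuo1997_exists_twist_L_one_ne_zero)
    (hMaz : mazur_not_dvd_maninConstant_of_odd) (hNS : integral_neronScaling_of_isGloballyMinimal)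
    (hCM : bsdTriple_of_hasCM_of_L_one_ne_zero) (hLLT : LiLiuTian2024.thm11_bsdp_of_cm_rank_one)
    (hKob : Kobayashi2013.cor14_bsdp_of_cm_rank_one)
    (hJ3 : ∀ (W : WeierstrassCurve ℚ) [W.IsElliptic] [W.IsGloballyMinimal] [NeZero (W.conductorNorm ℤ)]
      (p : ℕ) [Fact p.Prime], ClassX10 W p → ¬ Surj W 3 → ¬ W.HasCM → W.analyticRank = 1 →
      ∃ B : ℕ, ∀ (K : Type) [Field K] [NumberField K]
      (Dt : ModularParametrizationData W (W.conductorNorm ℤ)) (β : ℤ) (ι : K →+* ℂ),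
      IsImaginaryQuadratic K → B < (NumberField.discr K).natAbs →
      SatisfiesHeegnerHypothesis (W.conductorNorm ℤ) K → SatisfiesHeegnerHypothesis p K →
      (4 * (W.conductorNorm ℤ : ℤ)) ∣ β ^ 2 - NumberField.discr K → ¬ (p : ℤ) ∣ Dt.c →
      ∀ (d₁ : KolyvaginHeegnerData Dt β ι 1), ¬ IsOfFinAddOrder d₁.derivedPoint →
      ∀ (s : ℕ), s ≤ padicValNat p W.tamagawaProduct →
      ∀ (n : ℕ) (d : KolyvaginHeegnerData Dt β ι n), Squarefree n →
      (∀ ℓ ∈ n.primeFactors, Zhang2014.IsKolyvaginPrime (W.conductorNorm ℤ) W K p ℓ ∧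
        s ≤ Zhang2014.kolyvaginIndex W p ℓ) →
      ∃ Q : (W.baseChange (ringClassField K ι n)).toAffine.Point,
        ((p ^ s : ℕ) : ℤ) • Q = d.derivedPoint) :
    BSDpOnClassX10b :=
  Summit.BirchSwinnertonDyer.BirchSwinnertonDyer.Rank1Residual.X10.bsdpOnClassX10b_of_mazurMainConjectureOnClassX10b_of_heegnerDivisibility
    hGZ hKo hrec hD36 hChaU h526 h57 h331 hGr hGZK hmod hpar hnf hHL hMaz hNS hCM hLLT hKob
    (mazurMainConjectureOnClassX10b_of_muZeroSmallImageThree hμ3 h42 h49 h53 h37 hnf hpar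
      (SkinnerUrban2014.realPeriodRat_eq_unit_mul_plusPeriod_three_of_mazur hMaz) h526 h526c) hJ3

end Summit.BirchSwinnertonDyer.Rank1Residual.X10

end
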